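import Summits.KontsevichZagierPeriods.Zeta5Search.WedgeDictionaryDescent22
import Literature.NumberTheory.Irrationality.Zudilin2004.GroupStructureZeta3Closed
import HarnessLib

/-!
# Transport of Brown–Zudilin (22) to the dual side on the CLOSED Bailey cone (gen-1 g11)

HONEST FRAMING: systematic search; no irrationality claim unless certified.

OUR work (Summit side; cell `pub-zeta5`, planner gen-1 g11, 2026-08-20), the sequel of `WedgeDictionaryDescent22Transport` /
`WedgeDictionaryDescent22` (gen-1 g10).  There, each term of (22) was transported to a level-descent term under STRICT admissibility of
its level-5 vector `B(k)` (Zudilin 2004 (4.12), all sixteen `c_jk > 0`), because the Bailey / Rhin–Viola invariance was typed on the open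
cone only.  With the invariance typed on the CLOSED cone — `Zudilin2004.baileyTransformClosed` (`GroupStructureZeta3Closed`: the standing
hypothesis (2.2) of the source, all sixteen `c_jk ≥ 0`, `WeakAdmissible`) — every step of the transport goes through on the closed cone:

* `vwpDual_five_eq_J_weak` / `J3_eq_vwpDual_five_weak`: Zudilin 2002 (k = 3), `J₃ = λ·F̃₅(B)`, needs only `B_j ≥ 0`, `2B₀ − ΣB ≥ 0` and
  `c₁₂, c₂₃, c₃₄, c₄₅ ≥ 0` (the cited positive-parameter theorem `vwp_eq_integral_of_pos` at `h = (B₀+2; B_j+1)`);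
* `transportWeight_weak`: the weight identity (iv) `w_k·λ_k·Π(B(k)) = 2ρ·Ω_i·Π(𝔱B(k))` with NO admissibility hypothesis (the proof of
  `transportWeight` verbatim — it never used it: a relabelling of factorials through (18)–(19));
* `weakAdmissible_bFive`: under the level-descent box `2b_s ≤ N`, the residue range and CLAUSE 2 of the level descent
  (`c₁₂ ≤ d + max(0, b₇−b₁, b₇−b₂)`), EVERY `B(k)` of the binomial support of (22) is weakly admissible — sixteen linear inequalities,
  `omega`.  (The sixteen parameters of `B(k)` are a permutation of those of the degenerate shape `𝔱₁₃₄B(k) = (N; b₃, b₇−i, b₄, b₆, b₅)`,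
  `i = k − p₄`; fifteen signs follow from the region, the box and the support conditions `p₅, p₆ ≤ k`; the sixteenth,
  `2N − Σ = d − c₁₂ + i ≥ 0` — it is `c₂₅(B(k)) ≥ 0` — is clause 2 together with `i ≥ max(0, p₆−p₄, p₅−p₄) = max(0, b₇−b₁, b₇−b₂)`.)
* `term22_eq_weak`: one term of (22) = `2ρ` × one term of the level descent, for weakly admissible `B(k)`.
Cell census (exact, local, `code/gen1/g11/`): clause 2 cannot be dropped — at `a = (1,3,1,3,1,1,1,1)`, `k = 1`, `c₂₅(B(1)) = −1` and the
transported degenerate-shape series diverges (80 such points in `{1,…,4}⁸`); with clause 2, 0 exceptions in `{0,…,5}⁸` (54162 points).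
The assembly is `WedgeDictionaryDescent22Closed`.
-/

noncomputable section

open Finset

namespace Summit.KontsevichZagierPeriods.Zeta5Search.WedgeDictionary

open Summit.KontsevichZagierPeriods.Zeta5Search.DualSeries
open Literature.NumberTheory.Irrationality.BrownZudilin2022
  (vwpDual hOfB bOfA pOf qOf Converges cellularIntegral QOf zchoose J3 w22 rhs22 J3TermsConverge descent22)
open Literature.NumberTheory.Irrationality.Zudilin2002 (vwpSeries sorokinIntegral sorokinIntegrand vwp_eq_integral_of_pos)
open Literature.NumberTheory.Irrationality.Zudilin2004
  (Admissible WeakAdmissible cParams piNorm tau134 baileyTransform baileyTransformClosed weakAdmissible_tau134)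
open Literature.NumberTheory.Transcendental (zetaValue)

/-! ### Transport on the closed cone -/

/-- Zudilin 2002 (k = 3) in Brown–Zudilin's coordinates, for WEAKLY admissible integer `B` (the cited positive-parameter theorem needs
only `B_j ≥ 0`, `2B₀ − ΣB ≥ 0` and `c₁₂, c₂₃, c₃₄, c₄₅ ≥ 0`):
`λ(B) · F̃₅(B) = J₃(B₁+1; B₂+1, B₃+1, B₄+1 | B₀−B₃+2, B₀−B₄+2, B₀−B₅+2)`. -/
theorem vwpDual_five_eq_J_weak (hZ : vwp_eq_integral_of_pos) (B : ℕ → ℤ) (hB : WeakAdmissible B) :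
    (lamOf B : ℝ) * vwpDual 5 B =
      sorokinIntegral 3 ((B 1 : ℝ) + 1) (fun i => (B (i + 2) : ℝ) + 1) (fun i => (B 0 : ℝ) - B (i + 3) + 2) := by
  have h16 := hB
  unfold WeakAdmissible cParams at h16
  simp only [List.mem_cons, List.not_mem_nil, or_false, forall_eq_or_imp, forall_eq] at h16
  obtain ⟨c1, c2, c3, c4, c5, cS, c12, c13, c14, c15, c23, c24, c25, c34, c35, c45⟩ := h16
  have r0 : (0 : ℝ) ≤ B 0 := by exact_mod_cast (show 0 ≤ B 0 by omega)
  have r1 : (0 : ℝ) ≤ B 1 := by exact_mod_cast c1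
  have r2 : (0 : ℝ) ≤ B 2 := by exact_mod_cast c2
  have r3 : (0 : ℝ) ≤ B 3 := by exact_mod_cast c3
  have r4 : (0 : ℝ) ≤ B 4 := by exact_mod_cast c4
  have r5 : (0 : ℝ) ≤ B 5 := by exact_mod_cast c5
  have rS : ((B 1 : ℤ) : ℝ) + B 2 + B 3 + B 4 + B 5 < 2 * B 0 + 1 := by
    exact_mod_cast (show B 1 + B 2 + B 3 + B 4 + B 5 < 2 * B 0 + 1 by omega)
  have r12 : ((B 1 : ℤ) : ℝ) + B 2 < B 0 + 1 := by exact_mod_cast (show B 1 + B 2 < B 0 + 1 by omega)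
  have r23 : ((B 2 : ℤ) : ℝ) + B 3 < B 0 + 1 := by exact_mod_cast (show B 2 + B 3 < B 0 + 1 by omega)
  have r34 : ((B 3 : ℤ) : ℝ) + B 4 < B 0 + 1 := by exact_mod_cast (show B 3 + B 4 < B 0 + 1 by omega)
  have r45 : ((B 4 : ℤ) : ℝ) + B 5 < B 0 + 1 := by exact_mod_cast (show B 4 + B 5 < B 0 + 1 by omega)
  have H := hZ 3 (hOfB B) (by norm_num)
    (by
      rw [show Finset.Icc 1 (3 + 2) = ({1, 2, 3, 4, 5} : Finset ℕ) by decide]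
      simp [hOfB]
      linarith)
    (by
      intro j hj
      rw [show Finset.Icc 2 (3 + 1) = ({2, 3, 4} : Finset ℕ) by decide] at hj
      simp only [Finset.mem_insert, Finset.mem_singleton] at hj
      rcases hj with rfl | rfl | rfl <;> simp [hOfB] <;> constructor <;> linarith)
    (by simp [hOfB]; linarith) (by simp [hOfB]; linarith) (by simp [hOfB]; linarith) (by simp [hOfB]; linarith)
  rw [show Finset.Icc 1 (3 + 1) = ({1, 2, 3, 4} : Finset ℕ) by decide, Finset.prod_insert (by decide),
    Finset.prod_insert (by decide), Finset.prod_insert (by decide), Finset.prod_singleton] at H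
  simp only [Nat.reduceAdd] at H
  rw [Gamma_pair B one_ne_zero two_ne_zero c12, Gamma_pair B two_ne_zero three_ne_zero c23,
    Gamma_pair B three_ne_zero four_ne_zero c34, Gamma_pair B four_ne_zero (by norm_num) c45,
    Gamma_slot B one_ne_zero c1, Gamma_slot B (by norm_num) c5] at H
  rw [sorokinIntegral_congr3 (a₀' := hOfB B 1) (f' := fun i => hOfB B (i + 2)) (g' := fun i => 1 + hOfB B 0 - hOfB B (i + 3))
    (by simp [hOfB]) (fun i _ => by simp [hOfB]) (fun i _ => by simp [hOfB]; ring), ← H]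
  unfold Literature.NumberTheory.Irrationality.BrownZudilin2022.vwpDual
  simp only [lamOf, facQ]
  push_cast
  ring

/-- **(i), closed cone.** For weakly admissible `B(k)`: `J₃(p₀,p₁,p₂,p₃−k; q₁,q₂,q₃−p₆+k) = λ_k · F̃₅(B(k))`. -/
theorem J3_eq_vwpDual_five_weak (hZ : vwp_eq_integral_of_pos) (a : Fin 8 → ℤ) (k : ℤ) (hadm : WeakAdmissible (bFive a k)) :
    J3 (pOf a 0) (pOf a 1) (pOf a 2) (pOf a 3 - k) (qOf a 0) (qOf a 1) (qOf a 2 - pOf a 6 + k) =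
      (lamQ a k : ℝ) * vwpDual 5 (bFive a k) := by
  rw [show lamQ a k = lamOf (bFive a k) from rfl, vwpDual_five_eq_J_weak hZ _ hadm]
  unfold J3
  refine sorokinIntegral_congr3 ?_ ?_ ?_
  · simp [bFive]
  · intro i hi
    interval_cases i <;> simp [bFive]
  · intro i hi
    interval_cases i <;> simp [bFive, pOf, qOf] <;> ring

/-- **(iv), no admissibility hypothesis.** `w_k · λ_k · Π(B(k)) = 2ρ(a)·Ω_{k−p₄}(b(a))·Π(𝔱B(k))` on the support of (22) — the proof
of `transportWeight` verbatim (it never used admissibility: a relabelling of factorials through (18)–(19)). -/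
theorem transportWeight_weak (a : Fin 8 → ℤ) (k : ℤ) (hreg : ∀ i ∈ Icc 1 7, 0 ≤ bOfA a i ∧ 2 * bOfA a i ≤ bOfA a 0 + 1)
    (hp : ∀ i, 0 ≤ pOf a i) (hk : k ∈ Icc (pOf a 4) (pOf a 4 + qOf a 3)) (h5 : pOf a 5 ≤ k) (h6 : pOf a 6 ≤ k)
    (hJ : J3TermsConverge (pOf a) (qOf a)) :
    (w22 (pOf a) (qOf a) k : ℚ) * lamQ a k * piB a k = 2 * rhoOf a * ldWeight (bOfA a) (k - pOf a 4) * piT a k := by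
  -- coordinates
  have ep0 : pOf a 0 = a 4 + a 5 - a 7 := by simp [pOf]
  have ep1 : pOf a 1 = a 1 + a 2 + a 5 - a 3 - a 7 := by simp [pOf]
  have ep2 : pOf a 2 = a 5 := by simp [pOf]
  have ep3 : pOf a 3 = a 1 + a 2 + a 5 - a 7 := by simp [pOf]
  have ep4 : pOf a 4 = a 6 := by simp [pOf]
  have ep5 : pOf a 5 = a 2 + a 5 - a 7 := by simp [pOf]
  have ep6 : pOf a 6 = a 0 + a 1 + a 5 - a 3 - a 7 := by simp [pOf]
  have eq0 : qOf a 0 = a 3 := by simp [qOf]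
  have eq1 : qOf a 1 = a 4 := by simp [qOf]
  have eq3 : qOf a 3 = a 0 := by simp [qOf]
  have eq4 : qOf a 4 = a 1 := by simp [qOf]
  have eb0 : bOfA a 0 = a 1 + a 2 + a 3 := rfl
  have eb1 : bOfA a 1 = -a 0 + a 2 + a 3 := rfl
  have eb2 : bOfA a 2 = a 1 := rfl
  have eb3 : bOfA a 3 = a 3 := rfl
  have eb4 : bOfA a 4 = a 1 + a 2 - a 4 := rfl
  have eb5 : bOfA a 5 = a 1 + a 2 - a 7 := rfl
  have eb6 : bOfA a 6 = a 3 - a 5 + a 7 := rfl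
  have eb7 : bOfA a 7 = a 1 + a 2 + a 5 - a 6 - a 7 := rfl
  have eB0 : bFive a k 0 = pOf a 1 + qOf a 0 + qOf a 1 := by simp [bFive]
  have eB1 : bFive a k 1 = pOf a 0 := by simp [bFive]
  have eB2 : bFive a k 2 = pOf a 3 - k := by simp [bFive]
  have eB3 : bFive a k 3 = pOf a 1 := by simp [bFive]
  have eB4 : bFive a k 4 = qOf a 1 := by simp [bFive]
  have eB5 : bFive a k 5 = pOf a 1 + qOf a 0 - pOf a 2 := by simp [bFive]
  -- integer facts
  have hk' := mem_Icc.1 hk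
  obtain ⟨j1, -, -, -⟩ := hJ k hk h6
  have hp4 := hp 4; have hp5 := hp 5; have hp6 := hp 6
  have hS0 : 0 ≤ ∑ j ∈ range 7, bOfA a (j + 1) :=
    Finset.sum_nonneg fun j hj => (hreg (j + 1) (by have := mem_range.1 hj; simp only [mem_Icc]; omega)).1
  have hX0 : 0 ≤ pOf a 4 + pOf a 5 + pOf a 6 + k := by omega
  have hk5 : k - pOf a 5 ≤ qOf a 4 := by rw [ep5, eq4]; rw [ep3] at j1; omega
  -- the binomials as factorials
  have hw : (w22 (pOf a) (qOf a) k : ℚ) = (-1 : ℚ) ^ (pOf a 4 + pOf a 5 + pOf a 6 + k).toNat *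
      (facQ k / (facQ (pOf a 6) * facQ (k - pOf a 6))) * (facQ (qOf a 3) / (facQ (k - pOf a 4) * facQ (qOf a 3 - (k - pOf a 4)))) *
      (facQ (qOf a 4) / (facQ (k - pOf a 5) * facQ (qOf a 4 - (k - pOf a 5)))) := by
    unfold w22
    push_cast
    rw [zchoose_facQ (hp 6) h6, zchoose_facQ (by omega) (by omega), zchoose_facQ (by omega) hk5]
  -- the signs: `sign(w) = sign(ρ) · sign(Ω)`
  have hsign : (-1 : ℚ) ^ (pOf a 4 + pOf a 5 + pOf a 6 + k).toNat =
      (-1 : ℚ) ^ (∑ j ∈ range 7, bOfA a (j + 1)).toNat *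
        (-1 : ℚ) ^ (bOfA a 0 - bOfA a 1 - bOfA a 6 + (bOfA a 0 - bOfA a 2 - bOfA a 6) + (k - pOf a 4) +
          ∑ j ∈ range 7, bOfA a (j + 1)) := by
    rw [← zpow_natCast, ← zpow_natCast, Int.toNat_of_nonneg hX0, Int.toNat_of_nonneg hS0, ← zpow_add₀ (by norm_num)]
    apply neg_one_zpow_eq_of_even_sub
    refine ⟨pOf a 4 - ∑ j ∈ range 7, bOfA a (j + 1), ?_⟩
    simp only [sum_range_succ, sum_range_zero, ep4, ep5, ep6, eb0, eb1, eb2, eb3, eb4, eb5, eb6, eb7]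
    ring
  rw [hw, hsign]
  simp only [lamQ, lamOf, piB, piT, rhoOf, ldWeight, Epairs, List.map, List.prod_cons, List.prod_nil, prod_Icc_three_six,
    dOf_bOfA, eB0, eB1, eB2, eB3, eB4, eB5, facQ]
  simp only [sum_range_succ, sum_range_zero, ep0, ep1, ep2, ep3, ep4, ep5, ep6, eq0, eq1, eq3, eq4,
    eb0, eb1, eb2, eb3, eb4, eb5, eb6, eb7]
  ring_nf
  field_simp

/-- **Clause 2 ⟹ every support term is weakly admissible.**  The sixteen parameters of `B(k)` are those of
`𝔱₁₃₄B(k) = (N; b₃, b₇−i, b₄, b₆, b₅)`: the slots, the ten `N − x − y` (`≥ 0` by the level-descent box `2b_s ≤ N`), and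
`2N − Σ = d − c₁₂ + i ≥ 0` exactly when `i ≥ c₁₂ − d`, i.e. on the whole `i`-range iff clause 2. -/
theorem weakAdmissible_bFive (a : Fin 8 → ℤ) (k : ℤ) (hreg : ∀ i ∈ Icc 1 7, 0 ≤ bOfA a i ∧ 2 * bOfA a i ≤ bOfA a 0 + 1)
    (h2b : ∀ i ∈ Icc 1 7, 2 * bOfA a i ≤ bOfA a 0)
    (hcl2 : bOfA a 0 - bOfA a 1 - bOfA a 2 ≤ dOf (bOfA a) + max 0 (max (bOfA a 7 - bOfA a 1) (bOfA a 7 - bOfA a 2)))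
    (hk : k ∈ Icc (pOf a 4) (pOf a 4 + qOf a 3)) (h5 : pOf a 5 ≤ k) (h6 : pOf a 6 ≤ k) (hres : pOf a 4 + qOf a 3 ≤ pOf a 3) :
    WeakAdmissible (bFive a k) := by
  have r3 := (hreg 3 (by simp)).1
  have r4 := (hreg 4 (by simp)).1
  have r5 := (hreg 5 (by simp)).1
  have r6 := (hreg 6 (by simp)).1
  have s3 := h2b 3 (by simp)
  have s4 := h2b 4 (by simp)
  have s5 := h2b 5 (by simp)
  have s6 := h2b 6 (by simp)
  have s7 := h2b 7 (by simp)
  have hk' := mem_Icc.1 hk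
  rw [dOf_bOfA] at hcl2
  simp only [bOfA] at r3 r4 r5 r6 s3 s4 s5 s6 s7 hcl2
  have ep0 : pOf a 0 = a 4 + a 5 - a 7 := by simp [pOf]
  have ep1 : pOf a 1 = a 1 + a 2 + a 5 - a 3 - a 7 := by simp [pOf]
  have ep2 : pOf a 2 = a 5 := by simp [pOf]
  have ep3 : pOf a 3 = a 1 + a 2 + a 5 - a 7 := by simp [pOf]
  have ep4 : pOf a 4 = a 6 := by simp [pOf]
  have ep5 : pOf a 5 = a 2 + a 5 - a 7 := by simp [pOf]
  have ep6 : pOf a 6 = a 0 + a 1 + a 5 - a 3 - a 7 := by simp [pOf]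
  have eq0 : qOf a 0 = a 3 := by simp [qOf]
  have eq1 : qOf a 1 = a 4 := by simp [qOf]
  have eq3 : qOf a 3 = a 0 := by simp [qOf]
  rw [ep4, eq3] at hk'
  rw [ep5] at h5
  rw [ep6] at h6
  rw [ep4, eq3, ep3] at hres
  unfold WeakAdmissible cParams
  simp only [List.mem_cons, List.not_mem_nil, or_false, forall_eq_or_imp, forall_eq]
  simp only [bFive, ep0, ep1, ep2, ep3, eq0, eq1]
  norm_num
  omega

/-- The seven inequalities of `WeakAdmissible (tShape a k)` used below, unfolded. -/
theorem tShape_ineqs_weak (a : Fin 8 → ℤ) (k : ℤ) (h : WeakAdmissible (tShape a k)) :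
    0 ≤ bOfA a 3 ∧ 0 ≤ bOfA a 7 - (k - pOf a 4) ∧ 0 ≤ bOfA a 4 ∧ 0 ≤ bOfA a 6 ∧ 0 ≤ bOfA a 5 ∧
      0 ≤ 2 * bOfA a 0 - (bOfA a 3 + (bOfA a 7 - (k - pOf a 4)) + bOfA a 4 + bOfA a 6 + bOfA a 5) ∧
      0 ≤ bOfA a 0 - bOfA a 3 - (bOfA a 7 - (k - pOf a 4)) := by
  unfold WeakAdmissible cParams at h
  simp only [List.mem_cons, List.not_mem_nil, or_false, forall_eq_or_imp, forall_eq] at h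
  simp only [tShape] at h
  norm_num at h
  omega

/-- One term of (22) = one term of the level descent (times `2ρ`), as real numbers — closed-cone version of `term22_eq`. -/
theorem term22_eq_weak (hZ : vwp_eq_integral_of_pos) (hBc : baileyTransformClosed)
    (a : Fin 8 → ℤ) (k : ℤ) (hreg : ∀ i ∈ Icc 1 7, 0 ≤ bOfA a i ∧ 2 * bOfA a i ≤ bOfA a 0 + 1)
    (hp : ∀ i, 0 ≤ pOf a i) (hk : k ∈ Icc (pOf a 4) (pOf a 4 + qOf a 3)) (h5 : pOf a 5 ≤ k)
    (h6 : pOf a 6 ≤ k) (hJ : J3TermsConverge (pOf a) (qOf a)) (hadm : WeakAdmissible (bFive a k)) :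
    (w22 (pOf a) (qOf a) k : ℝ) * J3 (pOf a 0) (pOf a 1) (pOf a 2) (pOf a 3 - k) (qOf a 0) (qOf a 1) (qOf a 2 - pOf a 6 + k) =
      ((2 * rhoOf a * ldWeight (bOfA a) (k - pOf a 4) : ℚ) : ℝ) *
        ((coeffW (degShape (bOfA a) (k - pOf a 4)) : ℝ) * zetaValue 3 - coeffV (degShape (bOfA a) (k - pOf a 4))) := by
  have hadmT : WeakAdmissible (tShape a k) := by rw [← tau134_bFive]; exact weakAdmissible_tau134 hadm
  obtain ⟨t3, t7, t4, t6, t5, tS, t37⟩ := tShape_ineqs_weak a k hadmT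
  have r3 := hreg 3 (by simp)
  have r4 := hreg 4 (by simp)
  have r5 := hreg 5 (by simp)
  have r6 := hreg 6 (by simp)
  have r7 := hreg 7 (by simp)
  have hN : 0 ≤ bOfA a 0 := by omega
  have hIn : InBox (degShape (bOfA a) (k - pOf a 4)) :=
    inBox_degShape _ _ hN ⟨r3.1, by omega⟩ ⟨r4.1, by omega⟩ ⟨r5.1, by omega⟩ ⟨r6.1, by omega⟩ ⟨by omega, by omega⟩
  have hsum : ∑ j ∈ range 7, degShape (bOfA a) (k - pOf a 4) (j + 1) ≤ 3 * degShape (bOfA a) (k - pOf a 4) 0 + 1 := by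
    rw [sum_degShape]; simp only [degShape]; norm_num; omega
  have hU : coeffU (degShape (bOfA a) (k - pOf a 4)) = 0 :=
    LevelDescent.coeffU_eq_zero_of_slot_one _ hIn hsum (by simp [degShape])
  have hdec := (vwp_decomposition _ hIn hsum).2
  rw [hU] at hdec
  -- the analytic chain
  have hJ3 := J3_eq_vwpDual_five_weak hZ a k hadm
  have hBT := baileyTransformClosed.slots134 hBc (bFive a k) hadm
  rw [tau134_bFive] at hBT
  have hπB0 := piNorm_ne_zero (bFive a k)
  have hπT0 := piNorm_ne_zero (tShape a k)
  have hv : vwpDual 5 (bFive a k) = (piNorm (bFive a k) : ℝ) / (piNorm (tShape a k) : ℝ) * vwpDual 5 (tShape a k) := by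
    rw [div_eq_div_iff hπB0 hπT0] at hBT
    field_simp
    linarith
  have hπB : (piNorm (bFive a k) : ℝ) = ((piB a k : ℚ) : ℝ) := by
    rw [← piNorm_bFive]; push_cast; rfl
  have hπT : (piNorm (tShape a k) : ℝ) = ((piT a k : ℚ) : ℝ) := by
    rw [← piNorm_tShape]; push_cast; rfl
  have hTw := transportWeight_weak a k hreg hp hk h5 h6 hJ
  have hTw' : ((w22 (pOf a) (qOf a) k : ℚ) : ℝ) * ((lamQ a k : ℚ) : ℝ) * ((piB a k : ℚ) : ℝ) =
      ((2 * rhoOf a * ldWeight (bOfA a) (k - pOf a 4) : ℚ) : ℝ) * ((piT a k : ℚ) : ℝ) := by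
    exact_mod_cast congrArg (fun x : ℚ => (x : ℝ)) hTw
  have hπT0' : ((piT a k : ℚ) : ℝ) ≠ 0 := by rw [← hπT]; exact hπT0
  rw [hJ3, hv, vwpDual_tShape a k hN, hdec, hπB, hπT]
  have hw : (w22 (pOf a) (qOf a) k : ℝ) = ((w22 (pOf a) (qOf a) k : ℚ) : ℝ) := by push_cast; rfl
  rw [hw]
  calc ((w22 (pOf a) (qOf a) k : ℚ) : ℝ) * (((lamQ a k : ℚ) : ℝ) * (((piB a k : ℚ) : ℝ) / ((piT a k : ℚ) : ℝ) *
          ((0 : ℚ) * zetaValue 5 + (coeffW (degShape (bOfA a) (k - pOf a 4)) : ℝ) * zetaValue 3 -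
            coeffV (degShape (bOfA a) (k - pOf a 4)))))
        = ((w22 (pOf a) (qOf a) k : ℚ) : ℝ) * ((lamQ a k : ℚ) : ℝ) * ((piB a k : ℚ) : ℝ) / ((piT a k : ℚ) : ℝ) *
          ((coeffW (degShape (bOfA a) (k - pOf a 4)) : ℝ) * zetaValue 3 - coeffV (degShape (bOfA a) (k - pOf a 4))) := by
          push_cast; ring
    _ = _ := by rw [hTw']; field_simp

end Summit.KontsevichZagierPeriods.Zeta5Search.WedgeDictionary
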